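/-
Copyright (c) 2026 the pub-hodgecm-mathlib formalisation cell (harness21).  Prover seat hodgecm-mathlib-B-p04 (g47): LH4-plan (g6) WORD #3∕#5 brick (W3b)
«the discriminant of a type-(2) class is a conj-FIXED class times a square»; 2026-09-02.
-/
import Literature.NumberTheory.Rogawski1990.QuasiSplitRankTwoPrescribedCharpoly   -- ★ `exists_ne_zero_eq_neg_mul_map` (quadratic Hilbert 90), `exists_charpoly_eq_X_sub_C_mul_of_isRoot` (σ-reciprocity of the quotient)
import HarnessLib

/-!
# The discriminant of a σ-reciprocal quadratic `X² − tX + d` (`d·σd = 1`, `t = σt·d`) is a σ-FIXED element times a square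
# (Rogawski 1990, §3.5–§3.6 pp. 29–33: the `U(2)`-part of a type-(2) class `γ_H = (g, u)`)

Topic `NumberTheory/Rogawski1990`; namespace `Literature.NumberTheory.Rogawski1990`.  THEOREMS ONLY (no definition, no instance, no notation, no named fact,
no `sorry`); field-generic, count-neutral; kernel lane `--supports stmt-HodgeConjecture-24833`.  Cell `pub/hodgecm-mathlib` (D-0151), crux H413 =
`stmt-HodgeConjecture-24833`, half A line LH4 (dyadic pay-down), LH4-plan (g6) WORD #3 (W3) ∕ WORD #5 layer **(W3b)** «UnitaryGroup∕CM algebra»: for the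
`U(2)`-part `g` of `γ_H = (g, u)` at a non-split place, `t = tr g`, `δ = det g` satisfy `δ·δ̄ = 1` and `t̄ = t∕δ` — in the tree this is the σ-RECIPROCITY of the
quotient `charpoly γ ∕ (X − β) = X² − tX + d` of a unitary `3 × 3` matrix by a norm-one root, ★ `exists_charpoly_eq_X_sub_C_mul_of_isRoot` (`d * σ d = 1`,
`t = σ t * d`).  CONSEQUENCE typed here: the discriminant `Δ = t² − 4d` has **`σΔ · d² = Δ`** and, by quadratic Hilbert 90 (`d = z ∕ σz`, ★
`exists_ne_zero_eq_neg_mul_map`), **`Δ = a · z²` with `σ a = a`, `z ≠ 0`** — «the discriminant of a type-(2) class is an `L⁺_v`-class times a square» (the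
biquadratic structure of `K₂ = L_w[g] ⊇ L⁺_v(√a)` without Galois theory).  Consumer: LH4's M3 file together with (W3a)
`LocalFields/UnramifiedQuadraticFixedClassSquare` («a conj-fixed `a` in the unramified-or-square class of `L_w` is a square»): `χ_g` irreducible over `L_w` ⇒
`Δ` is not in the unramified-or-square class of `L_w`.  HONEST LABEL: HC_CM is proved only modulo the 7 printed citations (2 remaining named inputs: hLiu418 =
stmt-HodgeConjecture-24832, h413 = stmt-HodgeConjecture-24833) until rung 0 closes; count-neutral (pays no organ, opens no road).

THE MATHEMATICS.  `σ` a ring endomorphism of a field `K`, `t d : K` with `d·σd = 1`, `t = σt·d`.  Then `σ(t² − 4d)·d² = (σt·d)² − 4d·(d·σd) = t² − 4d` (§1).  If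
`σ` is an involution and not the identity, quadratic Hilbert 90 gives `z ≠ 0` with `d·σz = z`; then `σz = σd·z`, so `σ(Δ∕z²) = σΔ∕(σd·z)² = σΔ·d²∕z² = Δ∕z²`:
`a := Δ∕z²` is σ-fixed and `Δ = a·z²` (§2).

## References
* [Rogawski1990] J. D. Rogawski, *Automorphic Representations of Unitary Groups in Three Variables*, Ann. of Math. Stud. 123 (1990), §3.5–§3.6 pp. 29–33
  (the tori of `H = U(2) × U(1)`, type (2): `T ≃ E¹ × (EK)¹`).
* [CasselsFrohlichANT1967] J. W. S. Cassels, A. Fröhlich (eds.), *Algebraic Number Theory* (1967), Ch. V §2.7 Prop. 5 (Hilbert 90, cyclic case).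
-/

set_option autoImplicit false

namespace Literature.NumberTheory.Rogawski1990

variable {K : Type*} [Field K] (σ : K →+* K)

/-! ## §1 `σΔ · d² = Δ` for the σ-reciprocal quadratic `X² − tX + d` -/

/-- **`σ(t² − 4d) · d² = t² − 4d`** when `d·σd = 1` and `t = σt·d` (the σ-reciprocal quadratic of ★ `exists_charpoly_eq_X_sub_C_mul_of_isRoot`):
`σ(t² − 4d)·d² = (σt·d)² − 4d·(d·σd)`.  For the `U(2)`-part `g` of a type-(2) class this reads `Δ̄ = Δ∕δ²` (`t̄ = t∕δ`, `δ̄ = δ⁻¹`).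
[cite: Rogawski1990, §3.5–§3.6 pp. 29–33] -/
theorem map_disc_mul_det_sq_of_reciprocal {t d : K} (hd : d * σ d = 1) (ht : t = σ t * d) :
    σ (t ^ 2 - 4 * d) * d ^ 2 = t ^ 2 - 4 * d := by
  rw [map_sub, map_mul, map_pow, map_ofNat]
  linear_combination (-(σ t * d + t)) * ht + (-(4 * d)) * hd

/-- **`σΔ = Δ ∕ d²`**, the divided form of `map_disc_mul_det_sq_of_reciprocal`. [cite: Rogawski1990, §3.5–§3.6 pp. 29–33] -/
theorem map_disc_of_reciprocal {t d : K} (hd : d * σ d = 1) (ht : t = σ t * d) :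
    σ (t ^ 2 - 4 * d) = (t ^ 2 - 4 * d) / d ^ 2 := by
  have hd0 : d ≠ 0 := left_ne_zero_of_mul_eq_one hd
  rw [eq_div_iff (pow_ne_zero 2 hd0), map_disc_mul_det_sq_of_reciprocal σ hd ht]

/-! ## §2 `Δ = a · z²` with `a` σ-fixed: quadratic Hilbert 90 -/

/-- **A Hilbert-90 witness `z` (`d·σz = z`, `z ≠ 0`) makes `Δ∕z²` σ-FIXED**: `σz = σd·z` (apply `σ`, `σ² = 1`), so `σ(Δ∕z²) = σΔ·d²∕z² = Δ∕z²`.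
[cite: Rogawski1990, §3.5–§3.6 pp. 29–33] [cite: CasselsFrohlichANT1967, Ch. V §2.7 Prop. 5] -/
theorem map_disc_div_sq_eq_self_of_reciprocal (hσσ : ∀ x, σ (σ x) = x) {t d z : K} (hd : d * σ d = 1) (ht : t = σ t * d)
    (hz : d * σ z = z) : σ ((t ^ 2 - 4 * d) / z ^ 2) = (t ^ 2 - 4 * d) / z ^ 2 := by
  have hd0 : d ≠ 0 := left_ne_zero_of_mul_eq_one hd
  -- `σ z = σ d · z`
  have hσz : σ z = σ d * z := by
    have h := congrArg σ hz
    rw [map_mul, hσσ] at h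
    rw [← h, mul_comm]
  rcases eq_or_ne z 0 with rfl | hz0
  · simp
  rw [map_div₀, map_pow, hσz, map_disc_of_reciprocal σ hd ht, mul_pow, div_div, ← mul_assoc]
  have hdd : d ^ 2 * σ d ^ 2 = 1 := by rw [← mul_pow, hd, one_pow]
  rw [hdd, one_mul]

/-- **THE DISCRIMINANT OF A σ-RECIPROCAL QUADRATIC IS A σ-FIXED ELEMENT TIMES A SQUARE.**  `σ` an involution of the field `K`, `σ ≠ id`; `d·σd = 1`,
`t = σt·d`.  Then `t² − 4d = a·z²` with `σ a = a` and `z ≠ 0` (`z` = the quadratic Hilbert-90 witness of `d`, ★ `exists_ne_zero_eq_neg_mul_map` at `−d`;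
`a = Δ∕z²`).  For the `U(2)`-part of a type-(2) class `γ_H = (g, u)` at a non-split place `v` of the CM field (`σ = σ_w`, `t = tr g`, `d = det g`, via ★
`exists_charpoly_eq_X_sub_C_mul_of_isRoot`): «`disc χ_g` is an `L⁺_v`-class times a square of `L_w`» — the biquadratic structure of `L_w[g]`.
[cite: Rogawski1990, §3.5–§3.6 pp. 29–33] [cite: CasselsFrohlichANT1967, Ch. V §2.7 Prop. 5] -/
theorem exists_map_eq_self_mul_sq_eq_disc_of_reciprocal (hσσ : ∀ x, σ (σ x) = x) (hσ : ∃ z, σ z ≠ z) {t d : K} (hd : d * σ d = 1)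
    (ht : t = σ t * d) : ∃ a z : K, σ a = a ∧ z ≠ 0 ∧ t ^ 2 - 4 * d = a * z ^ 2 := by
  -- quadratic Hilbert 90 for `−d`: `z = −(−d)·σz = d·σz`
  have hd' : (-d) * σ (-d) = 1 := by rw [map_neg, neg_mul_neg, hd]
  obtain ⟨z, hz0, hz⟩ := exists_ne_zero_eq_neg_mul_map σ hσσ hσ hd'
  rw [neg_neg] at hz
  refine ⟨(t ^ 2 - 4 * d) / z ^ 2, z, map_disc_div_sq_eq_self_of_reciprocal σ hσσ hd ht hz.symm, hz0, ?_⟩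
  rw [div_mul_cancel₀ _ (pow_ne_zero 2 hz0)]

end Literature.NumberTheory.Rogawski1990
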